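import Literature.NumberTheory.LFunctions.KowalskiMichelHarmonicMoments
import Literature.NumberTheory.LFunctions.KloostermanWeil
import Literature.NumberTheory.EllipticCurves.NewformPeterssonSizeSymmSquareProofs
import Literature.Analysis.FunctionSpaces.BesselJ
import HarnessLib

/-!
# Petersson's formula at prime level and weight `2` WITH its Kloosterman–Bessel term
(Kowalski–Michel 2000, §2.4.2), and the range of the bound (23)

Source section typed here (D-0064): E. Kowalski, P. Michel, *A lower bound for the rank of
`J_0(q)`*, Acta Arith. 94 (2000), §2.4.2 «Applying Petersson's formula», p. 312
[held: paper:doi-10-4064-aa-94-4-303-343, PDF p. 10], read on the page: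

  "For any `l₁` and `l₂`, Petersson's formula is
  `∑ʰ_f λ_f(l₁) λ_f(l₂) = δ(l₁, l₂) − J(l₁, l₂)` where
  `J(l₁, l₂) = (2π/q) ∑_{r ≥ 1} r⁻¹ S(l₁, l₂; qr) J₁(4π √(l₁ l₂)/(qr))`.
  The trivial bound for this, from Weil's bound for Kloosterman sums and `J₁(x) ≪ x`, is
  (23) `J(l₁, l₂) ≪_ε (l₁ l₂)^{1/2+ε} q^{−3/2}`."

(`q` prime, weight `2`, `∑ʰ` = the harmonic average over `S_2(q)^*` of the companion file
`KowalskiMichelHarmonicMoments.lean`, i.e. the tree's `KowalskiMichel2000.pet q l₁ l₂`;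
`S(a, b; c)` = the tree's classical Kloosterman sum `Literature.NumberTheory.LFunctions.kloostermanSum`
of `KloostermanPrimePower.lean`; `J₁` = the tree's Bessel function
`Literature.Analysis.FunctionSpaces.besselJ 1` of `BesselJ.lean`.)

## What is typed

* Definitions with bodies: `petKloostermanTerm q l₁ l₂ r` (the `r`-th term
  `r⁻¹ S(l₁,l₂;qr) J₁(4π√(l₁l₂)/(qr))`, `0` at `r = 0`) and `petJ q l₁ l₂ = J(l₁, l₂)`.
* Named fact AS PRINTED: `kowalskiMichel2000_peterssonFormula` (the exact formula, the series
  converging absolutely — the convergence is the content of the printed words "from Weil's bound …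
  and `J₁(x) ≪ x`").
* **Misstatement record (D-0014 honesty).** The companion file's named fact
  `KowalskiMichel2000.kowalskiMichel2000_petersson` types the display of p. 310
  ("`∑ʰ λ_f(m)λ_f(n) = δ(m,n) + O_ε((mn)^{1/2+ε} q^{−3/2})` (see below (23))") for ALL `m, n ≥ 1`.
  In print that display is used only for `m, n ≤ M = q^Δ < q^{1/2}` (§2.3) and, through (23), for
  pairs `(n, m)`, `(qn, m)` with `(m, q) = 1` (§2.4.2); it is FALSE at `m = n = q`: by Atkin–Lehner
  (`a_f(q)² = 1` for `f ∈ S_2(q)^*`, the tree's theorem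
  `IsNewform0.cuspCoeff_sq_eq_one_of_dvd_of_not_sq_dvd`) one has `λ_f(q)² = 1/q`, hence
  `∑ʰ λ_f(q)² = q⁻¹ ∑ʰ 1` (`pet_level_level`), which is `∼ 1/q`, not `1 + O(q^{−1/2+2ε})`.
  This file PROVES `not_kowalskiMichel2000_petersson : ¬ kowalskiMichel2000_petersson` (Literature
  side, route-independent; the same refutation was found independently the same hour by the cell's
  refuters — «R2-G44», with a Summits-side negative lemma of record) and vendors the corrected
  statement under a NEW name, `kowalskiMichel2000_peterssonBound`, with the extra hypothesis
  `¬ (q ∣ m ∧ q ∣ n)` (for `q` prime: `((m, n), q) = 1`, see `gcd_coprime_iff_not_dvd`; the name of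
  record for the cell's re-thread), which contains every use made in the paper and on which (23) does follow from
  Weil's bound `|S(m,n;c)| ≤ (m,n,c)^{1/2} c^{1/2} τ(c)` (the gcd `(m, n, qr) = ((m, n), r)` is then
  prime to `q`) and `|J₁(x)| ≤ x/2`. The old def is left in place unchanged (never edit a def's
  meaning in place); its dependents take it as a hypothesis `(hP : kowalskiMichel2000_petersson)`
  and are therefore VACUOUS as stated until re-threaded to `kowalskiMichel2000_peterssonBound`.

Kept out of `KowalskiMichelHarmonicMoments.lean` (append protocol) on purpose: that file has
twenty-odd importers and this one needs the Kloosterman, Bessel and Atkin–Lehner imports.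

## References

* E. Kowalski, P. Michel, *A lower bound for the rank of `J_0(q)`*, Acta Arith. 94 (2000)
  303–343, p. 310 (display after (16)), §2.4.2 p. 312 (Petersson's formula, (23)).
  [held: paper:doi-10-4064-aa-94-4-303-343] [KowalskiMichel2000]
* H. Iwaniec, *Spectral methods of automorphic forms*, 2nd ed. (2002), (2.25) (Weil's bound, the
  tree's `weil_kloosterman_bound`). [Iwaniec2002]
* A. O. L. Atkin, J. Lehner, *Hecke operators on `Γ₀(m)`*, Math. Ann. 185 (1970), Thm. 3.
  [AtkinLehner1970]
-/

noncomputable section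

open scoped MatrixGroups Real
open CongruenceSubgroup Complex
open Literature.NumberTheory.EllipticCurves.ModularForms
open Literature.Analysis.FunctionSpaces (besselJ)

namespace Literature.NumberTheory.LFunctions.KowalskiMichel2000

/-! ### Petersson's formula with its off-diagonal term (Kowalski–Michel p. 312) -/

section Formula

variable (q : ℕ) [NeZero q]

/-- The `r`-th term `r⁻¹ S(l₁, l₂; qr) J₁(4π √(l₁ l₂)/(qr))` of Kowalski–Michel's `J(l₁, l₂)`
(p. 312), for `r ≥ 1`; set to `0` at `r = 0` so that the series is indexed by `ℕ`.
[cite: KowalskiMichel2000, §2.4.2 p. 312 (definition of J(l₁,l₂))] -/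
def petKloostermanTerm (l₁ l₂ r : ℕ) : ℂ :=
  if h : r = 0 then 0 else
    haveI : NeZero (q * r) := ⟨mul_ne_zero (NeZero.ne q) h⟩
    (r : ℂ)⁻¹ * kloostermanSum (q * r) (l₁ : ZMod (q * r)) (l₂ : ZMod (q * r)) *
      ((besselJ 1 (4 * π * Real.sqrt ((l₁ : ℝ) * l₂) / ((q : ℝ) * r)) : ℝ) : ℂ)

/-- The term at `r = 0` is `0` (indexing convention for Kowalski–Michel's `∑_{r ≥ 1}`, p. 312).
[cite: KowalskiMichel2000, §2.4.2 p. 312 (definition of J(l₁,l₂))] -/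
@[simp] theorem petKloostermanTerm_zero (l₁ l₂ : ℕ) : petKloostermanTerm q l₁ l₂ 0 = 0 := by
  simp [petKloostermanTerm]

/-- Unfolding the term at `r ≠ 0`. [cite: KowalskiMichel2000, §2.4.2 p. 312 (definition of J(l₁,l₂))] -/
theorem petKloostermanTerm_of_ne_zero (l₁ l₂ : ℕ) {r : ℕ} (hr : r ≠ 0) :
    petKloostermanTerm q l₁ l₂ r =
      haveI : NeZero (q * r) := ⟨mul_ne_zero (NeZero.ne q) hr⟩
      (r : ℂ)⁻¹ * kloostermanSum (q * r) (l₁ : ZMod (q * r)) (l₂ : ZMod (q * r)) *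
        ((besselJ 1 (4 * π * Real.sqrt ((l₁ : ℝ) * l₂) / ((q : ℝ) * r)) : ℝ) : ℂ) := by
  simp [petKloostermanTerm, hr]

/-- **Kowalski–Michel's `J(l₁, l₂) := (2π/q) ∑_{r ≥ 1} r⁻¹ S(l₁, l₂; qr) J₁(4π √(l₁ l₂)/(qr))`**,
the off-diagonal (Kloosterman–Bessel) term of Petersson's formula at prime level `q`, weight `2`
(p. 312; = `−2π i^{−k} ∑_{c ≡ 0 (q)} c⁻¹ S(l₁,l₂;c) J_{k−1}(4π√(l₁l₂)/c)` at `k = 2`).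
[cite: KowalskiMichel2000, §2.4.2 p. 312 (definition of J(l₁,l₂))] -/
def petJ (l₁ l₂ : ℕ) : ℂ :=
  2 * π / q * ∑' r : ℕ, petKloostermanTerm q l₁ l₂ r

/-- Unfolding `petJ`. [cite: KowalskiMichel2000, §2.4.2 p. 312 (definition of J(l₁,l₂))] -/
theorem petJ_def (l₁ l₂ : ℕ) :
    petJ q l₁ l₂ = 2 * π / q * ∑' r : ℕ, petKloostermanTerm q l₁ l₂ r :=
  rfl

/-- **Kowalski–Michel 2000, §2.4.2, p. 312: Petersson's formula at prime level `q`, weight `2`.**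
Printed: "For any `l₁` and `l₂`, Petersson's formula is `∑ʰ_f λ_f(l₁)λ_f(l₂) = δ(l₁,l₂) − J(l₁,l₂)`
where `J(l₁,l₂) = (2π/q) ∑_{r≥1} r⁻¹ S(l₁,l₂;qr) J₁(4π√(l₁l₂)/(qr))`. The trivial bound for this,
from Weil's bound for Kloosterman sums and `J₁(x) ≪ x`, is `J(l₁,l₂) ≪_ε (l₁l₂)^{1/2+ε} q^{−3/2}`"
— `q` prime, `∑ʰ` over `S_2(q)^*` with weights `1/(4π(f,f))` (the tree's `pet q l₁ l₂`),
`l₁, l₂ ≥ 1`; the absolute convergence of the `r`-series (by the quoted bounds) is typed as part of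
the statement. [cite: KowalskiMichel2000, §2.4.2 p. 312 (Petersson's formula)] -/
def kowalskiMichel2000_peterssonFormula : Prop :=
  ∀ (q : ℕ) [NeZero q], q.Prime → ∀ l₁ l₂ : ℕ, 1 ≤ l₁ → 1 ≤ l₂ →
    Summable (fun r : ℕ ↦ ‖petKloostermanTerm q l₁ l₂ r‖) ∧
      pet q l₁ l₂ = (if l₁ = l₂ then 1 else 0) - petJ q l₁ l₂

/-- **Kowalski–Michel 2000, p. 310 (display after (16)) with (23), IN ITS RANGE** — the corrected
form of the companion file's `kowalskiMichel2000_petersson`: for every `ε > 0` there is `C` with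
`|∑ʰ_{f ∈ S_2(q)^*} λ_f(m)λ_f(n) − δ(m,n)| ≤ C (mn)^{1/2+ε} q^{−3/2}` for all primes `q` and all
`m, n ≥ 1` such that `q` does not divide both `m` and `n` (i.e. `((m, n), q) = 1`). Printed (p. 310):
"We only need the estimate `∑ʰ λ_f(m)λ_f(n) = δ(m,n) + O_ε((mn)^{1/2+ε} q^{−3/2})` (see below
(23))", used there for `m, n ≤ M = q^Δ`, `Δ < 1/2`, and (p. 312, "since `(m, q) = 1`") for
`J(n, m)`, `J(qn, m)`; on this range (23) follows from Weil's bound, the gcd `(m, n, qr) = ((m, n), r)`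
being prime to `q`, and `|J₁(x)| ≤ x/2`. The range keeps the tree's legitimate instantiations
`(1, 1)`, `(q, 1)` (the root-number sum) and all `l, m < q`; the unrestricted statement is refuted
below (`not_kowalskiMichel2000_petersson`, witness `(q, q)`).
[cite: KowalskiMichel2000, §2.3 p. 310 (display after (16)) and §2.4.2 p. 312 (23)] -/
def kowalskiMichel2000_peterssonBound : Prop :=
  ∀ ε : ℝ, 0 < ε → ∃ C : ℝ, ∀ (q : ℕ) [NeZero q], q.Prime → ∀ m n : ℕ, 1 ≤ m → 1 ≤ n →
    ¬ (q ∣ m ∧ q ∣ n) →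
      ‖pet q m n - (if m = n then 1 else 0)‖ ≤
        C * (((m : ℝ) * n) ^ (1 / 2 + ε)) * (q : ℝ) ^ (-(3 / 2 : ℝ))

/-- For `q` prime the side condition `¬ (q ∣ m ∧ q ∣ n)` of `kowalskiMichel2000_peterssonBound` is the
gcd condition `((m, n), q) = 1` of Weil's bound (either spelling instantiates through this lemma). [cite: KowalskiMichel2000, §2.4.2 p. 312 (23), range "(m, q) = 1"] -/
theorem gcd_coprime_iff_not_dvd {q : ℕ} (hq : q.Prime) (m n : ℕ) :
    (m.gcd n).Coprime q ↔ ¬ (q ∣ m ∧ q ∣ n) := by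
  rw [Nat.coprime_comm, hq.coprime_iff_not_dvd, Nat.dvd_gcd_iff]

/-- The side condition at the tree's instantiation `(m, n) = (q, 1)` (and at `(1, 1)`), gcd spelling:
it holds. [cite: KowalskiMichel2000, §2.4.2 p. 312 (23), range "(m, q) = 1"] -/
theorem gcd_one_right_coprime (m q : ℕ) : (m.gcd 1).Coprime q := by
  rw [Nat.gcd_one_right]
  exact Nat.coprime_one_left q

/-- The side condition at `n = 1` (instantiations `(q, 1)`, `(1, 1)`), `¬`-spelling: a prime does
not divide `1`. [cite: KowalskiMichel2000, §2.4.2 p. 312 (23), range "(m, q) = 1"] -/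
theorem not_dvd_and_dvd_one {q : ℕ} (hq : q.Prime) (m : ℕ) : ¬ (q ∣ m ∧ q ∣ 1) :=
  fun h ↦ hq.one_lt.ne' (Nat.dvd_one.mp h.2)

/-- The side condition below the level: if `1 ≤ n < q` then `q ∤ n`, so `¬ (q ∣ m ∧ q ∣ n)` (the
mollifier/amplifier instantiations `l, m ≤ q̂^Δ < q`). [cite: KowalskiMichel2000, §2.3 p. 310 (display after (16)), range m, n ≤ M] -/
theorem not_dvd_and_dvd_of_lt {q m n : ℕ} (hn : 1 ≤ n) (hnq : n < q) : ¬ (q ∣ m ∧ q ∣ n) :=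
  fun h ↦ absurd (Nat.le_of_dvd (by omega) h.2) (not_le.mpr hnq)

/-- The unrestricted statement implies the restricted one (recorded only to fix the direction of
the correction: the new fact is WEAKER than the companion file's typing of the p. 310 display).
[cite: KowalskiMichel2000, §2.3 p. 310 (display after (16))] -/
theorem peterssonBound_of_petersson (h : kowalskiMichel2000_petersson) :
    kowalskiMichel2000_peterssonBound := by
  intro ε hε
  obtain ⟨C, hC⟩ := h ε hε
  exact ⟨C, fun q _ hq m n hm hn _ ↦ hC q hq m n hm hn⟩

end Formula

/-! ### The misstatement record: `λ_f(q)² = 1/q` and the refutation of the unrestricted bound -/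

section Refutation

/-- For `q` prime and `f ∈ S_2(q)^*` (a newform of level `Γ₀(q)`, weight `2`): `λ_f(q)² = 1/q`,
since `a_f(q)² = 1` (Atkin–Lehner 1970, Thm. 3; the tree's
`IsNewform0.cuspCoeff_sq_eq_one_of_dvd_of_not_sq_dvd`) and `λ_f(q) = a_f(q) q^{−1/2}`
(Kowalski–Michel p. 309: `ε_f = −q^{1/2} λ_f(q) = ±1`). [cite: AtkinLehner1970, Thm. 3] -/
theorem heckeLambda_level_sq {q : ℕ} [NeZero q] (hq : q.Prime) {f : CuspForm (Gamma0 q) 2}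
    (hf : IsNewform0 f) : GL2Family.heckeLambda f q ^ 2 = (q : ℂ)⁻¹ := by
  have hq0 : (q : ℂ) ≠ 0 := Nat.cast_ne_zero.mpr hq.ne_zero
  have hsq : ¬ q ^ 2 ∣ q := by
    intro h
    have hle : q ^ 2 ≤ q := Nat.le_of_dvd hq.pos h
    have h2 : 2 ≤ q := hq.two_le
    nlinarith
  have ha : cuspCoeff f q ^ 2 = 1 := hf.cuspCoeff_sq_eq_one_of_dvd_of_not_sq_dvd hq dvd_rfl hsq
  rw [GL2Family.heckeLambda, mul_pow, ha, one_mul, ← Complex.cpow_nat_mul]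
  have hexp : ((2 : ℕ) : ℂ) * -((((2 : ℤ) : ℂ) - 1) / 2) = -1 := by push_cast; ring
  rw [hexp, Complex.cpow_neg_one]

/-- For `q` prime: `∑ʰ_{f ∈ S_2(q)^*} λ_f(q)² = q⁻¹ ∑ʰ_{f ∈ S_2(q)^*} 1`
(`= q⁻¹ ∑ʰ λ_f(1)²`, `λ_f(1) = 1`). [cite: AtkinLehner1970, Thm. 3] -/
theorem pet_level_level {q : ℕ} [NeZero q] (hq : q.Prime) :
    pet q q q = (q : ℂ)⁻¹ * pet q 1 1 := by
  rw [pet, pet, ← GL2Family.harmonicSum_const_mul]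
  unfold GL2Family.harmonicSum
  refine finsum_mem_congr rfl fun f hf ↦ ?_
  have hf' : IsNewform0 f := hf
  beta_reduce
  rw [GL2Family.heckeLambda_one_of_isNormalized hf'.2.2, ← sq, heckeLambda_level_sq hq hf']
  ring

/-- **The companion file's `kowalskiMichel2000_petersson` (all `m, n ≥ 1`) is FALSE**: at
`m = n = q` it asserts `|∑ʰ λ_f(q)² − 1| ≤ C q^{2ε − 1/2}`, whereas `∑ʰ λ_f(q)² = q⁻¹ ∑ʰ 1` and,
by the same fact at `m = n = 1`, `|∑ʰ 1 − 1| ≤ C q^{−3/2}`; for `ε = 1/8` and `q` a large prime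
(primes are unbounded) the two are incompatible. The printed statement (p. 310, range of (23)) is
not affected: see `kowalskiMichel2000_peterssonBound`. [cite: KowalskiMichel2000, §2.3 p. 310 (display after (16)), range] -/
theorem not_kowalskiMichel2000_petersson : ¬ kowalskiMichel2000_petersson := by
  intro h
  obtain ⟨C, hC⟩ := h (1 / 8) (by norm_num)
  set A : ℝ := |C| + 1 with hA_def
  have hA1 : 1 ≤ A := by have := abs_nonneg C; linarith
  obtain ⟨q, hqN, hq⟩ := Nat.exists_infinite_primes (⌈(2 * A) ^ 4⌉₊ + ⌈4 * A⌉₊)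
  haveI : NeZero q := ⟨hq.ne_zero⟩
  have hq1 : (1 : ℝ) ≤ q := by exact_mod_cast hq.one_lt.le
  have hqpos : (0 : ℝ) < q := by linarith
  -- the two instances of the (false) fact
  have h11 := hC q hq 1 1 le_rfl le_rfl
  have hqq := hC q hq q q hq.one_lt.le hq.one_lt.le
  simp only [if_true, Nat.cast_one, mul_one] at h11 hqq
  -- (1,1): ‖pet q 1 1 − 1‖ ≤ |C|
  have hb11 : ‖pet q 1 1 - 1‖ ≤ |C| := by
    refine h11.trans ?_
    rw [Real.one_rpow, mul_one]
    calc C * (q : ℝ) ^ (-(3 / 2 : ℝ)) ≤ |C| * (q : ℝ) ^ (-(3 / 2 : ℝ)) := by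
          gcongr
          exact le_abs_self C
      _ ≤ |C| * 1 := by
          gcongr
          exact Real.rpow_le_one_of_one_le_of_nonpos hq1 (by norm_num)
      _ = |C| := mul_one _
  have hn11 : ‖pet q 1 1‖ ≤ A := by
    calc ‖pet q 1 1‖ = ‖(pet q 1 1 - 1) + 1‖ := by rw [sub_add_cancel]
      _ ≤ ‖pet q 1 1 - 1‖ + ‖(1 : ℂ)‖ := norm_add_le _ _
      _ ≤ |C| + 1 := by rw [norm_one]; linarith
  -- (q,q): lower bound from `pet q q q = q⁻¹ pet q 1 1`
  have hnqq : ‖pet q q q‖ ≤ A / q := by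
    rw [pet_level_level hq, norm_mul, norm_inv, Complex.norm_natCast, div_eq_inv_mul]
    gcongr
  have hlow : 1 - A / q ≤ ‖pet q q q - 1‖ := by
    have h := norm_sub_norm_le (1 : ℂ) (pet q q q)
    rw [norm_one, norm_sub_rev] at h
    linarith
  -- (q,q): upper bound `≤ |C| q^{−1/4}`
  have hexp : ((q : ℝ) * q) ^ (1 / 2 + 1 / 8 : ℝ) * (q : ℝ) ^ (-(3 / 2 : ℝ)) =
      (q : ℝ) ^ (-(1 / 4 : ℝ)) := by
    rw [Real.mul_rpow hqpos.le hqpos.le, ← Real.rpow_add hqpos, ← Real.rpow_add hqpos]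
    norm_num
  have hup : ‖pet q q q - 1‖ ≤ |C| * (q : ℝ) ^ (-(1 / 4 : ℝ)) := by
    refine hqq.trans ?_
    rw [mul_assoc, hexp]
    gcongr ?_ * _
    exact le_abs_self C
  -- `q` is large
  have hq_ge1 : (4 * A : ℝ) ≤ q := by
    have h' : ((⌈4 * A⌉₊ : ℕ) : ℝ) ≤ q := by exact_mod_cast (Nat.le_add_left _ _).trans hqN
    exact (Nat.le_ceil _).trans h'
  have hq_ge2 : ((2 * A) ^ 4 : ℝ) ≤ q := by
    have h' : ((⌈(2 * A) ^ 4⌉₊ : ℕ) : ℝ) ≤ q := by exact_mod_cast (Nat.le_add_right _ _).trans hqN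
    exact (Nat.le_ceil _).trans h'
  have h1 : A / q ≤ 1 / 4 := by
    rw [div_le_iff₀ hqpos]
    linarith
  have h2 : |C| * (q : ℝ) ^ (-(1 / 4 : ℝ)) ≤ 1 / 2 := by
    have h2A : 0 ≤ 2 * A := by linarith
    have hroot : 2 * A ≤ (q : ℝ) ^ (1 / 4 : ℝ) := by
      calc 2 * A = ((2 * A) ^ 4) ^ (1 / 4 : ℝ) := by
            rw [show (1 / 4 : ℝ) = ((4 : ℕ) : ℝ)⁻¹ by norm_num,
              Real.pow_rpow_inv_natCast h2A (by norm_num)]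
        _ ≤ (q : ℝ) ^ (1 / 4 : ℝ) := Real.rpow_le_rpow (by positivity) hq_ge2 (by norm_num)
    have hqr : 0 < (q : ℝ) ^ (1 / 4 : ℝ) := Real.rpow_pos_of_pos hqpos _
    rw [Real.rpow_neg hqpos.le, ← div_eq_mul_inv, div_le_iff₀ hqr]
    nlinarith [abs_nonneg C]
  linarith [hlow, hup, h1, h2]

end Refutation

end Literature.NumberTheory.LFunctions.KowalskiMichel2000

end
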